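import Literature.AlgebraicGeometry.Resolution.QuasiRegularSequences
import Mathlib.RingTheory.MvPolynomial.Homogeneous
import Mathlib.RingTheory.LocalRing.ResidueField.Basic
import Mathlib.RingTheory.Polynomial.Quotient
import Mathlib.RingTheory.Filtration
import HarnessLib

/-!
# The initial ideal of a hypersurface in a quasi-regular local ring is generated by the initial form

Support file for crux stmt-ResolutionOfSingularities-15316 (`FrobeniusLadder.FRationalModification`, line
`socle-discrepancy-certificate`, stub `stub_maxMultiplicityCertificate`): the tangent-cone half of the
certificate on the exceptional divisor of the blow-up of a maximal-multiplicity hypersurface point.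

Let `(S, 𝔪)` be a Noetherian local ring whose maximal ideal is generated by a QUASI-REGULAR sequence
`x = (x₀, …, x_{r-1})` (Matsumura §16; e.g. a regular system of parameters of a regular local ring), so
that `gr_𝔪(S) = κ[T₀, …, T_{r-1}]`, and let `f = F(x)` for a form `F ∈ S[T]` of degree `D` with a unit
coefficient (`F ∉ 𝔪 S[T]`: the initial form `F̄ ∈ κ[T]` of `f` is non-zero of degree `D`). Then the
initial forms of the elements of `(f)` are the multiples of `F̄`:

* `exists_sub_mul_mem_of_isHomogeneous` — if a form `H` of degree `N` satisfies `H(x) ≡ s·f mod 𝔪^{N+1}`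
  for some `s ∈ S`, then `H ≡ F·G mod 𝔪 S[T]` for some `G` (compare `N` with `D + ord s`, using that
  `𝔪 S[T]` is prime and quasi-regularity: a form of degree `ν` with value in `𝔪^{ν+1}` lies in `𝔪 S[T]`);
* `exists_sub_mul_mem_map` — the same read in a quotient `R = S/(f)` (`π : S → R` onto, kernel `(f)`,
  `xb = π ∘ x`): a form `H ∈ R[T]` of degree `N` with `H(xb) ∈ 𝔪_R^{N+1}` satisfies `H ≡ F_R · G`
  modulo `𝔪_R R[T]`, `F_R = π F` — i.e. **`gr_{𝔪}(S/(f)) = κ[T]/(F̄)`** in the form the blow-up chart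
  computation (`…MaxMultiplicityCertificateTangentChart`) consumes.

References: H. Matsumura, *Commutative Ring Theory*, §16 (quasi-regular sequences, Thm. 16.2) and
Thm. 14.4/§17 for regular sequences; the statement (initial ideal of a principal ideal) is folklore,
e.g. Eisenbud, *Commutative Algebra*, Exercise 5.3 / Prop. 5.3 context. [folklore]
-/

-- single-problem summit: the doubled namespace component is forced
set_option linter.dupNamespace false

noncomputable section

namespace Summit.ResolutionOfSingularities.ResolutionOfSingularities.Theorems.FRationalModification.MaxMultiplicityCertificateInitialForm

open MvPolynomial IsLocalRing Literature.AlgebraicGeometry.Resolution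

/-! ## Two facts about `𝔪 S[T]` -/

/-- `𝔪 S[T]` is a prime ideal of `S[T]` for a local ring `(S, 𝔪)`: it is the kernel of
`S[T] → κ[T]`. [folklore] -/
theorem isPrime_map_C_maximalIdeal {S : Type*} [CommRing S] [IsLocalRing S] (ι : Type*) :
    (Ideal.map (C : S →+* MvPolynomial ι S) (maximalIdeal S)).IsPrime := by
  have h := RingHom.ker_isPrime (MvPolynomial.map (σ := ι) (residue S))
  rwa [ker_map, ker_residue] at h

variable {S : Type*} [CommRing S] [IsNoetherianRing S] [IsLocalRing S] {r : ℕ} (x : Fin r → S)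
  (hx : Ideal.span (Set.range x) = maximalIdeal S)

include hx in
/-- **Order and initial form of a non-zero element**: in a Noetherian local ring with
`𝔪 = (x₀, …, x_{r-1})`, every `s ≠ 0` is `G(x)` for a form `G` of degree `j = ord s` with a unit
coefficient (Krull's intersection theorem gives `j`; `G ∈ 𝔪 S[T]` would force `s ∈ 𝔪^{j+1}`).
[folklore] -/
theorem exists_isHomogeneous_eval_eq_notMem {s : S} (hs : s ≠ 0) :
    ∃ (j : ℕ) (G : MvPolynomial (Fin r) S), G.IsHomogeneous j ∧ eval x G = s ∧
      G ∉ Ideal.map C (Ideal.span (Set.range x)) := by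
  classical
  have hex : ∃ j : ℕ, s ∉ Ideal.span (Set.range x) ^ j := by
    by_contra h
    push Not at h
    have hmem : s ∈ ⨅ j : ℕ, Ideal.span (Set.range x) ^ j := Ideal.mem_iInf.mpr h
    rw [hx, Ideal.iInf_pow_eq_bot_of_isLocalRing _ (maximalIdeal.isMaximal S).ne_top] at hmem
    exact hs hmem
  have h0 : Nat.find hex ≠ 0 := by
    intro h
    have := Nat.find_spec hex
    rw [h, pow_zero, Ideal.one_eq_top] at this
    exact this trivial
  obtain ⟨j, hj⟩ := Nat.exists_eq_succ_of_ne_zero h0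
  have hsj : s ∈ Ideal.span (Set.range x) ^ j := by
    have := Nat.find_min hex (m := j) (by omega)
    push Not at this
    exact this
  obtain ⟨G, hG, hGs⟩ := exists_isHomogeneous_of_mem_span_pow x j hsj
  refine ⟨j, G, hG, hGs, fun hGm => ?_⟩
  have h1 := eval_mem_mul_span_pow x hG hGm
  rw [hGs, ← pow_succ'] at h1
  exact (hj ▸ Nat.find_spec hex) h1

/-! ## The initial ideal of `(f)` -/

include hx in
/-- **Initial forms of multiples of `f` are multiples of the initial form of `f`.** Let
`𝔪 = (x₀, …, x_{r-1})` be generated by a quasi-regular sequence, `F` a form of degree `D` with a unit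
coefficient, `f = F(x)`. If a form `H` of degree `N` and `s ∈ S` satisfy `H(x) - s·f ∈ 𝔪^{N+1}`, then
`H - F·G ∈ 𝔪 S[T]` for some `G ∈ S[T]`. [folklore; Matsumura1987 Thm. 16.2] -/
theorem exists_sub_mul_mem_of_isHomogeneous (hqr : IsQuasiRegular x) {D : ℕ} {F : MvPolynomial (Fin r) S}
    (hF : F.IsHomogeneous D) (hFm : F ∉ Ideal.map C (Ideal.span (Set.range x))) {N : ℕ}
    {H : MvPolynomial (Fin r) S} (hH : H.IsHomogeneous N) {s : S}
    (hHs : eval x H - s * eval x F ∈ Ideal.span (Set.range x) ^ (N + 1)) :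
    ∃ G : MvPolynomial (Fin r) S, H - F * G ∈ Ideal.map C (Ideal.span (Set.range x)) := by
  haveI hprime : (Ideal.map (C : S →+* MvPolynomial (Fin r) S) (Ideal.span (Set.range x))).IsPrime := by
    rw [hx]
    exact isPrime_map_C_maximalIdeal (Fin r)
  by_cases hs0 : s = 0
  · subst hs0
    rw [zero_mul, sub_zero] at hHs
    exact ⟨0, by rw [mul_zero, sub_zero]; exact hqr N H hH hHs⟩
  obtain ⟨j, G, hG, hGs, hGm⟩ := exists_isHomogeneous_eval_eq_notMem x hx hs0
  have hFG : (F * G).IsHomogeneous (D + j) := hF.mul hG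
  have hFGx : eval x (F * G) = s * eval x F := by rw [map_mul, hGs, mul_comm]
  have hkey : F * G ∉ Ideal.map C (Ideal.span (Set.range x)) := fun h =>
    (hprime.mem_or_mem h).elim hFm hGm
  rcases lt_trichotomy N (D + j) with hlt | heq | hgt
  · -- `N < D + j`: then `H(x) ∈ 𝔪^{N+1}` and `H ∈ 𝔪 S[T]`
    have h1 : s * eval x F ∈ Ideal.span (Set.range x) ^ (N + 1) := by
      rw [← hFGx]
      exact Ideal.pow_le_pow_right (by omega) (eval_mem_span_pow x hFG)
    have h2 : eval x H ∈ Ideal.span (Set.range x) ^ (N + 1) := by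
      have := add_mem hHs h1
      rwa [sub_add_cancel] at this
    exact ⟨0, by rw [mul_zero, sub_zero]; exact hqr N H hH h2⟩
  · -- `N = D + j`: `H - F G` is a form of degree `N` with value in `𝔪^{N+1}`
    subst heq
    refine ⟨G, hqr (D + j) (H - F * G) (hH.sub hFG) ?_⟩
    rwa [map_sub, hFGx]
  · -- `D + j < N`: then `(F G)(x) ∈ 𝔪^{D+j+1}`, so `F G ∈ 𝔪 S[T]`, a prime not containing `F`, `G`
    exfalso
    have h1 : eval x H ∈ Ideal.span (Set.range x) ^ (D + j + 1) :=
      Ideal.pow_le_pow_right (by omega) (eval_mem_span_pow x hH)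
    have h2 : eval x H - s * eval x F ∈ Ideal.span (Set.range x) ^ (D + j + 1) :=
      Ideal.pow_le_pow_right (by omega) hHs
    have h3 : eval x (F * G) ∈ Ideal.span (Set.range x) ^ (D + j + 1) := by
      rw [hFGx]
      have := sub_mem h1 h2
      rwa [sub_sub_cancel] at this
    exact hkey (hqr (D + j) (F * G) hFG h3)

/-! ## Read in the hypersurface ring `R = S/(f)` -/

omit [IsNoetherianRing S] [IsLocalRing S] in
/-- A form over a quotient lifts to a form: if `π : S → R` is onto and `H ∈ R[T]` is homogeneous of
degree `N`, then `H = π H₀` for a form `H₀ ∈ S[T]` of degree `N` (lift arbitrarily and keep the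
degree-`N` component). [folklore] -/
theorem exists_isHomogeneous_map_eq {R : Type*} [CommRing R] {σ : Type*} (π : S →+* R)
    (hπ : Function.Surjective π) {N : ℕ} {H : MvPolynomial σ R} (hH : H.IsHomogeneous N) :
    ∃ H₀ : MvPolynomial σ S, H₀.IsHomogeneous N ∧ MvPolynomial.map π H₀ = H := by
  obtain ⟨H', hH'⟩ := map_surjective π hπ H
  refine ⟨homogeneousComponent N H', homogeneousComponent_isHomogeneous N H', ?_⟩
  ext m
  rw [coeff_map, coeff_homogeneousComponent]
  split_ifs with h
  · rw [← coeff_map, hH']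
  · rw [map_zero]
    exact (hH.coeff_eq_zero h).symm

omit [IsNoetherianRing S] [IsLocalRing S] in
/-- `𝔪 S[T]` maps into `𝔪_R R[T]` under `π : S[T] → R[T]` (`𝔪_R = π 𝔪`). [folklore] -/
theorem map_map_C_le {R : Type*} [CommRing R] (π : S →+* R) (xb : Fin r → R) (hxb : ∀ j, xb j = π (x j)) :
    (Ideal.map C (Ideal.span (Set.range x))).map (MvPolynomial.map (σ := Fin r) π) ≤
      Ideal.map C (Ideal.span (Set.range xb)) := by
  have hspan : Ideal.span (Set.range xb) = (Ideal.span (Set.range x)).map π := by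
    rw [Ideal.map_span, ← Set.range_comp]
    congr 1
    ext j
    exact ⟨fun ⟨a, ha⟩ => ⟨a, (hxb a).symm.trans ha⟩, fun ⟨a, ha⟩ => ⟨a, (hxb a).trans ha⟩⟩
  have hcomp : (MvPolynomial.map (σ := Fin r) π).comp C = C.comp π := RingHom.ext fun a => map_C π a
  rw [hspan, Ideal.map_map, hcomp, ← Ideal.map_map]

include hx in
/-- **The initial ideal of a hypersurface is generated by the initial form** (quotient form). With `S`,
`x` quasi-regular, `F` as above and `f = F(x)`: let `π : S → R` be onto with kernel `(f)` and
`xbⱼ = π xⱼ` (so `𝔪_R = (xb)`). If a form `H ∈ R[T]` of degree `N` has `H(xb) ∈ 𝔪_R^{N+1}`, then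
`H - π(F)·G ∈ 𝔪_R R[T]` for some `G ∈ R[T]`: in `gr_{𝔪_R}(R) = κ[T]/J` the relations `J` are the
multiples of the initial form `F̄`. [folklore; Matsumura1987 Thm. 16.2] -/
theorem exists_sub_mul_mem_map (hqr : IsQuasiRegular x) {D : ℕ} {F : MvPolynomial (Fin r) S}
    (hF : F.IsHomogeneous D) (hFm : F ∉ Ideal.map C (Ideal.span (Set.range x)))
    {R : Type*} [CommRing R] (π : S →+* R) (hπ : Function.Surjective π)
    (hker : ∀ s, π s = 0 ↔ s ∈ Ideal.span {eval x F}) (xb : Fin r → R) (hxb : ∀ j, xb j = π (x j))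
    {N : ℕ} {H : MvPolynomial (Fin r) R} (hH : H.IsHomogeneous N)
    (hHx : eval xb H ∈ Ideal.span (Set.range xb) ^ (N + 1)) :
    ∃ G : MvPolynomial (Fin r) R, H - MvPolynomial.map π F * G ∈ Ideal.map C (Ideal.span (Set.range xb)) := by
  -- lift `H` to a form `H₀` over `S`
  obtain ⟨H₀, hH₀, rfl⟩ := exists_isHomogeneous_map_eq π hπ hH
  -- `𝔪_R = π 𝔪`, so `H₀(x) ∈ 𝔪^{N+1} + (f)`
  have hfun : (⇑π ∘ x) = xb := funext fun j => (hxb j).symm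
  have hspan : Ideal.span (Set.range xb) = (Ideal.span (Set.range x)).map π := by
    rw [Ideal.map_span, ← Set.range_comp, hfun]
  have h1 : π (eval x H₀) ∈ ((Ideal.span (Set.range x)) ^ (N + 1)).map π := by
    rw [map_eval, hfun, Ideal.map_pow, ← hspan]
    exact hHx
  have h2 : eval x H₀ ∈ Ideal.span (Set.range x) ^ (N + 1) ⊔ Ideal.span {eval x F} := by
    have h3 : eval x H₀ ∈ (((Ideal.span (Set.range x)) ^ (N + 1)).map π).comap π :=
      Ideal.mem_comap.mpr h1
    rw [Ideal.comap_map_of_surjective π hπ] at h3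
    have hbot : Ideal.comap π ⊥ = Ideal.span {eval x F} := by
      ext s
      rw [Ideal.mem_comap, Ideal.mem_bot]
      exact hker s
    rwa [hbot] at h3
  obtain ⟨m, hm, t, ht, hmt⟩ := Submodule.mem_sup.mp h2
  obtain ⟨s, rfl⟩ := Ideal.mem_span_singleton'.mp ht
  have hHs : eval x H₀ - s * eval x F ∈ Ideal.span (Set.range x) ^ (N + 1) := by
    rw [← hmt, add_sub_cancel_right]
    exact hm
  -- the initial form divides, over `S`; push down to `R`
  obtain ⟨G, hG⟩ := exists_sub_mul_mem_of_isHomogeneous x hx hqr hF hFm hH₀ hHs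
  refine ⟨MvPolynomial.map π G, map_map_C_le x π xb hxb ?_⟩
  have := Ideal.mem_map_of_mem (MvPolynomial.map (σ := Fin r) π) hG
  rwa [map_sub, map_mul] at this

/-! ## Registered form -/

/-- **The initial ideal of a hypersurface is generated by its initial form** (registered helper-stub form,
fully explicit binders; = `exists_sub_mul_mem_map`): `(S, 𝔪)` Noetherian local with `𝔪 = (x₀, …, x_{r-1})`
quasi-regular, `F ∈ S[T]` a form of degree `D` with a unit coefficient, `π : S → R` onto with kernel
`(F(x))`, `x̄ⱼ = π xⱼ`; then every form `H ∈ R[T]` of degree `N` with `H(x̄) ∈ (x̄)^{N+1}` is `≡ π(F)·G`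
modulo `(x̄)·R[T]`. [folklore; Matsumura1987 Thm. 16.2] -/
theorem hypersurface_initialForm_rel (S : Type) [CommRing S] [IsNoetherianRing S] [IsLocalRing S] (r : ℕ)
    (x : Fin r → S) (hx : Ideal.span (Set.range x) = IsLocalRing.maximalIdeal S)
    (hqr : Literature.AlgebraicGeometry.Resolution.IsQuasiRegular x) (D : ℕ) (F : MvPolynomial (Fin r) S)
    (hF : F.IsHomogeneous D) (hFm : F ∉ Ideal.map MvPolynomial.C (Ideal.span (Set.range x)))
    (R : Type) [CommRing R] (π : S →+* R) (hπ : Function.Surjective π)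
    (hker : ∀ s, π s = 0 ↔ s ∈ Ideal.span {MvPolynomial.eval x F}) (xb : Fin r → R)
    (hxb : ∀ j, xb j = π (x j)) (N : ℕ) (H : MvPolynomial (Fin r) R) (hH : H.IsHomogeneous N)
    (hHx : MvPolynomial.eval xb H ∈ Ideal.span (Set.range xb) ^ (N + 1)) :
    ∃ G : MvPolynomial (Fin r) R,
      H - MvPolynomial.map π F * G ∈ Ideal.map MvPolynomial.C (Ideal.span (Set.range xb)) :=
  exists_sub_mul_mem_map x hx hqr hF hFm π hπ hker xb hxb hH hHx

end Summit.ResolutionOfSingularities.ResolutionOfSingularities.Theorems.FRationalModification.MaxMultiplicityCertificateInitialForm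

end
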